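import Literature.NumberTheory.EllipticCurves.GeomPointReduction
import Literature.NumberTheory.EllipticCurves.TorsionCardinality
import Literature.NumberTheory.EllipticCurves.SupersingularDensityDeuringCriterionProofs
import HarnessLib

/-!
# At an ordinary good prime the reduction map does not kill `E[p]`

Topic `NumberTheory/EllipticCurves`.  Theorems only (nothing is defined, no named fact).  For an
elliptic curve `E = W/ℚ` in global minimal form and a prime `p ∤ Δ_W` of good **ordinary**
reduction (`p ∤ a_p`), the reduction map `red : E(ℚ̄) → Ẽ(𝔽̄_p)` of the tree
(`GeomPointReduction.geomReduction`, along the place `placeOver p`) is nonzero on the `p`-torsion: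

  `∃ P ∈ E(ℚ̄), p • P = O, red P ≠ Õ` (`exists_zsmul_eq_zero_geomReduction_ne_zero`).

This is the (only) piece of J.-P. Serre, Invent. Math. 15 (1972), §1.11, Prop. 11 b) ("la suite
exacte `0 → X_p → E_p → Ẽ_p → 0`", i.e. `E[p] → Ẽ[p]` is onto the group `Ẽ[p]` of order `p` at an
ordinary place) that the counting skeleton `exists_forall_sub_mem_line_of_invariant`
(`SerreOpenImageOrdinaryLineProofs`) needs as its input `hf`: once `red|E[p] ≠ 0`, its kernel
`X_p = E[p] ∩ E₁` has order `≤ p` and is the line of Prop. 11.  Serre deduces b) from the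
structure of the formal group; here, over `ℚ̄`, we argue with division polynomials instead:

* `p ∤ a_p ⇒ Ẽ(𝔽̄_p)` has a point `(u, w)` of order `p` (the tree's
  `WeierstrassCurve.dvd_trace_of_forall_nsmul_ne_zero`,
  `SupersingularDensityDeuringCriterionProofs`, Silverman *AEC* V.3.1 / Ex. V.5.10(a)), so `u` is a root of `ΨSq_p(Ẽ)`, the reduction of the
  `p`-division polynomial `ΨSq_p ∈ 𝒪_𝔓[X]` of the model at the place (Mathlib `map_ΨSq`;
  `[p]P = O ↔ ΨSq_p(x(P)) = 0`, the tree's `zsmul_some_eq_zero_iff_eval_ΨSq`, *AEC* Ex. 3.7);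
* `ΨSq_p(Ẽ) ≠ 0` (otherwise every point of `Ẽ(𝔽̄_p)` would be killed by `p`, including the
  `(p+1)²` points of `Ẽ[p+1]`, the tree's `card_torsionBy_eq_sq`, *AEC* III.6.4(b)), so the
  reduction of `ΨSq_p` is a non-constant polynomial;
* **an integral polynomial over an algebraically closed valued field whose reduction is not
  constant has an integral root** (`exists_isRoot_of_natDegree_map_residue_ne_zero`; elementary:
  peel off the non-integral roots `α`, `F = (1 - α⁻¹X)·F₂` with `F₂` integral and `F̄ = F̄₂`);
* an integral root `a` of `ΨSq_p` carries an integral point `P = (a, b) ∈ E(ℚ̄)` (the monic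
  quadratic in `Y` has a root in `𝒪_𝔓`, as in the tree's `geomReduction_surjective`), which is
  `p`-torsion and reduces to the affine point `(ā, b̄) ≠ Õ`.

## References

* [Serre1972] J.-P. Serre, Invent. Math. 15 (1972) 259–331, §1.11, Prop. 11 and its proof.
* [SilvermanAEC2009] J. H. Silverman, *The Arithmetic of Elliptic Curves*, 2nd ed. (2009),
  Thm. V.3.1(a), Ex. V.5.10(a), Ex. 3.7(d),(f), Cor. III.6.4(b), Prop. VII.2.1.
-/

noncomputable section

open scoped Classical
open Polynomial WeierstrassCurve

namespace Literature.NumberTheory.EllipticCurves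

/-! ### Integral roots of integral polynomials over an algebraically closed valued field -/

section RootLifting

variable {L : Type*} [Field L] [IsAlgClosed L] (O : ValuationSubring L)

/-- If a polynomial `F ∈ L[X]` with `O`-integral coefficients over an algebraically closed field
`L` has **no** `O`-integral root, then all its coefficients of positive degree lie in the maximal
ideal (its reduction is a constant).  Induction on the degree: for a root `α` (so `|α| > 1`,
`β = α⁻¹ ∈ 𝔪`) write `F = (X - α)·G = (1 - βX)·F₂` with `F₂ = αG`; the recursion
`F₂,₀ = -F₀`, `F₂,ᵢ₊₁ = β F₂,ᵢ - Fᵢ₊₁` shows that `F₂` is integral, it has no integral root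
either, and `Fᵢ₊₁ = β F₂,ᵢ - F₂,ᵢ₊₁ ∈ 𝔪` by induction. [folklore] -/
theorem valuation_coeff_lt_one_of_forall_not_isRoot (n : ℕ) :
    ∀ F : L[X], F.natDegree = n → (∀ i, O.valuation (F.coeff i) ≤ 1) →
      (∀ a : L, O.valuation a ≤ 1 → ¬ F.IsRoot a) →
        ∀ i, i ≠ 0 → O.valuation (F.coeff i) < 1 := by
  induction n with
  | zero =>
    intro F hF _ _ i hi
    rw [coeff_eq_zero_of_natDegree_lt (by omega), map_zero]
    exact zero_lt_one
  | succ n ih =>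
    intro F hF hint hroot i hi
    set v := O.valuation with hv
    -- a root `α`, necessarily non-integral; `β = α⁻¹ ∈ 𝔪`
    have hF0 : F ≠ 0 := by
      rintro rfl
      rw [natDegree_zero] at hF
      exact Nat.succ_ne_zero n hF.symm
    have hdeg : F.degree ≠ 0 := by
      rw [degree_eq_natDegree hF0, hF]
      exact_mod_cast Nat.succ_ne_zero n
    obtain ⟨α, hα⟩ := IsAlgClosed.exists_root F hdeg
    have hα1 : 1 < v α := by
      by_contra h
      exact hroot α (not_lt.mp h) hα
    have hα0 : α ≠ 0 := by
      rintro rfl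
      rw [map_zero] at hα1
      exact not_lt_zero hα1
    set β := α⁻¹ with hβ
    have hβα : β * α = 1 := inv_mul_cancel₀ hα0
    have hβ1 : v β < 1 := by
      by_contra h
      rw [not_lt] at h
      have h' : v α ≤ v β * v α := by
        calc v α = 1 * v α := (one_mul _).symm
          _ ≤ v β * v α := mul_le_mul' h le_rfl
      rw [← map_mul, hβα, map_one] at h'
      exact lt_irrefl _ (hα1.trans_le h')
    have hβle : v β ≤ 1 := hβ1.le
    -- `F = (X - α) G`, `F₂ = α G`, `G = β F₂`
    set G := F /ₘ (X - C α) with hG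
    have hXG : (X - C α) * G = F := mul_divByMonic_eq_iff_isRoot.mpr hα
    set F₂ := C α * G with hF₂
    have hGF₂ : G = C β * F₂ := by
      rw [hF₂, ← mul_assoc, ← C_mul, hβα, C_1, one_mul]
    have hc0 : F.coeff 0 = -F₂.coeff 0 := by
      rw [← hXG, sub_mul, coeff_sub, coeff_X_mul_zero, zero_sub]
    have hcs : ∀ i, F.coeff (i + 1) = β * F₂.coeff i - F₂.coeff (i + 1) := by
      intro i
      rw [← hXG, sub_mul, coeff_sub, coeff_X_mul, hGF₂, coeff_C_mul, ← hGF₂]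
    -- `F₂` is integral
    have hint₂ : ∀ i, v (F₂.coeff i) ≤ 1 := by
      intro i
      induction i with
      | zero =>
        have h0 : F₂.coeff 0 = -F.coeff 0 := by rw [hc0, neg_neg]
        rw [h0, Valuation.map_neg]
        exact hint 0
      | succ i ih₂ =>
        have hs : F₂.coeff (i + 1) = β * F₂.coeff i - F.coeff (i + 1) := by
          rw [hcs i]; ring
        rw [hs]
        refine (v.map_sub _ _).trans (max_le ?_ (hint _))
        rw [map_mul]
        exact mul_le_one' hβle ih₂
    -- `F₂` has degree `n` and no integral root
    have hF₂deg : F₂.natDegree = n := by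
      rw [hF₂, natDegree_C_mul hα0, hG, natDegree_divByMonic F (monic_X_sub_C α), hF,
        natDegree_X_sub_C, Nat.add_sub_cancel]
    have hroot₂ : ∀ a : L, v a ≤ 1 → ¬ F₂.IsRoot a := by
      intro a ha h2
      apply hroot a ha
      have hGa : G.eval a = 0 := by
        have h2' : (C α * G).eval a = 0 := h2
        rw [eval_mul, eval_C] at h2'
        exact (mul_eq_zero.mp h2').resolve_left hα0
      rw [IsRoot, ← hXG, eval_mul, hGa, mul_zero]
    have ih₂ := ih F₂ hF₂deg hint₂ hroot₂
    -- conclusion: `F_{j+1} = β F₂,j - F₂,j+1 ∈ 𝔪`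
    obtain ⟨j, rfl⟩ := Nat.exists_eq_succ_of_ne_zero hi
    rw [hcs j]
    refine lt_of_le_of_lt (v.map_sub _ _) (max_lt ?_ (ih₂ _ (Nat.succ_ne_zero j)))
    rw [map_mul]
    calc v β * v (F₂.coeff j) ≤ v β * 1 := mul_le_mul' le_rfl (hint₂ j)
      _ = v β := mul_one _
      _ < 1 := hβ1

/-- **Root lifting over an algebraically closed valued field.**  A polynomial `F ∈ 𝒪[X]` over a
valuation ring `𝒪` of an algebraically closed field whose reduction `F̄ ∈ k[X]` is not constant
has a root in `𝒪` (so, e.g., every root of `F̄` is the reduction of a root of `F` when `F̄ ≠ 0`;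
we only need the existence).  No henselian / completeness hypothesis is needed since `L` is
algebraically closed. [folklore] -/
theorem exists_isRoot_of_natDegree_map_residue_ne_zero (F : O[X])
    (hF : (F.map (IsLocalRing.residue O)).natDegree ≠ 0) : ∃ a : O, F.IsRoot a := by
  by_contra hno
  push Not at hno
  -- some coefficient of positive degree is a unit
  obtain ⟨i, hi, hunit⟩ : ∃ i, i ≠ 0 ∧ IsUnit (F.coeff i) := by
    by_contra hall
    push Not at hall
    apply hF
    rw [natDegree_eq_zero_iff_degree_le_zero, degree_le_iff_coeff_zero]
    intro m hm
    have hm0 : m ≠ 0 := by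
      rintro rfl
      exact lt_irrefl _ hm
    rw [coeff_map, IsLocalRing.residue_eq_zero_iff]
    exact (IsLocalRing.mem_maximalIdeal _).mpr (hall m hm0)
  have hvi : O.valuation (F.coeff i : L) = 1 := (O.valuation_eq_one_iff _).mp hunit
  -- the integral polynomial `F` over `L` has no integral root
  set FL : L[X] := F.map (algebraMap O L) with hFL
  have hint : ∀ j, O.valuation (FL.coeff j) ≤ 1 := fun j ↦ by
    rw [hFL, coeff_map]
    exact O.valuation_le_one _
  have hroot : ∀ a : L, O.valuation a ≤ 1 → ¬ FL.IsRoot a := by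
    intro a ha h
    have ha' : a ∈ O := (O.valuation_le_one_iff a).mp ha
    apply hno ⟨a, ha'⟩
    have h' : algebraMap O L (F.eval ⟨a, ha'⟩) = 0 := by
      rw [← eval₂_at_apply, ← eval_map, ← hFL]
      exact h
    exact (map_eq_zero_iff _ (IsFractionRing.injective O L)).mp h'
  have hlt := valuation_coeff_lt_one_of_forall_not_isRoot O FL.natDegree FL rfl hint hroot i hi
  rw [hFL, coeff_map] at hlt
  exact (lt_irrefl _) (hvi ▸ hlt)

end RootLifting

/-! ### Ordinary reduction: a `p`-torsion point of `E(ℚ̄)` with nonzero reduction -/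

section Ordinary

variable (p : ℕ) [Fact p.Prime] {W : WeierstrassCurve ℚ} [W.IsGloballyMinimal]

/-- **Ordinary means `Ẽ[p] ≠ 0`**: if `p ∤ a_p(W)` then the reduction `Ẽ` has a point of order
`p` over `𝔽̄_p` (contrapositive of the tree's `dvd_trace_of_forall_nsmul_ne_zero`:
`Ẽ(𝔽̄_p)[p] = 0 ⇒ p ∣ a_p`). Silverman, *AEC*, Thm. V.3.1(a); Serre 1972, §1.11 ("bonne réduction
de hauteur 1"). [cite: SilvermanAEC2009, Thm. V.3.1(a) and Ex. V.5.10(a)] -/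
theorem exists_ne_zero_nsmul_eq_zero_of_not_dvd_frobeniusTrace
    (hΔ : ¬ (p : ℤ) ∣ minimalDiscriminantInt W) (hord : ¬ (p : ℤ) ∣ W.frobeniusTrace p) :
    ∃ Q : (reductionModPrime W p).geomPoints, Q ≠ 0 ∧ p • Q = 0 := by
  haveI : (reductionModPrime W p).IsElliptic := isElliptic_reductionModPrime W hΔ
  by_contra hT
  push Not at hT
  obtain ⟨σ, hσ⟩ := WeierstrassCurve.exists_frobenius_absoluteGaloisGroup (ZMod p)
  have h := (reductionModPrime W p).dvd_trace_of_forall_nsmul_ne_zero p hσ hT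
  rw [Nat.card_zmod, ← frobeniusTrace_eq_sub_natCard_reductionModPrime] at h
  exact hord h

/-- **At an ordinary good prime, `red : E[p] → Ẽ(𝔽̄_p)` is not zero** (Serre 1972, §1.11,
Prop. 11 b): `E_p → Ẽ_p` is onto the group `Ẽ_p` of order `p`; here only `≠ 0`): there is a
`p`-torsion point `P ∈ E(ℚ̄)` whose reduction along the place `placeOver p` is not `Õ`.
Proof by division polynomials and root lifting, see the module docstring.
[cite: Serre1972, §1.11 Prop. 11 b)] [cite: SilvermanAEC2009, Ex. 3.7(d),(f) and Prop. VII.2.1] -/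
theorem exists_zsmul_eq_zero_geomReduction_ne_zero [W.IsElliptic]
    (hΔ : ¬ (p : ℤ) ∣ minimalDiscriminantInt W) (hord : ¬ (p : ℤ) ∣ W.frobeniusTrace p) :
    ∃ P : W.geomPoints, (p : ℤ) • P = 0 ∧ geomReduction hΔ P ≠ 0 := by
  haveI : (reductionModPrime W p).IsElliptic := isElliptic_reductionModPrime W hΔ
  set O := placeOver p with hO
  set M := placeModel p W with hM
  set r := placeResidueMap p with hr
  set Ebar := (reductionModPrime W p).baseChange (AlgebraicClosure (ZMod p)) with hEbar
  have hcurve : M.map r = Ebar := placeModel_map_placeResidueMap p W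
  set F : O[X] := M.ΨSq p with hFdef
  have hFr : F.map r = Ebar.ΨSq p := by rw [← hcurve, map_ΨSq]
  -- Step 1: a point of order `p` downstairs; its abscissa is a root of `ΨSq_p(Ē)`
  obtain ⟨Q, hQ0, hpQ⟩ := exists_ne_zero_nsmul_eq_zero_of_not_dvd_frobeniusTrace p hΔ hord
  obtain ⟨u, hu⟩ : ∃ u, (F.map r).eval u = 0 := by
    rcases Q with _ | ⟨u, w, huw⟩
    · exact absurd rfl hQ0
    · refine ⟨u, ?_⟩
      rw [hFr, ← zsmul_some_eq_zero_iff_eval_ΨSq Ebar huw p, natCast_zsmul]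
      exact hpQ
  -- Step 2: `ΨSq_p(Ē) ≠ 0`, testing on a nonzero `(p+1)`-torsion point
  have hFr0 : F.map r ≠ 0 := by
    intro h0
    have hp : p.Prime := Fact.out
    have hp1 : ((p + 1 : ℕ) : AlgebraicClosure (ZMod p)) ≠ 0 := by
      rw [Nat.cast_succ, CharP.cast_eq_zero (AlgebraicClosure (ZMod p)) p, zero_add]
      exact one_ne_zero
    have hcard := card_torsionBy_eq_sq (E := Ebar) hp1
    haveI : Finite (AddSubgroup.torsionBy Ebar.toAffine.Point ((p + 1 : ℕ) : ℤ)) :=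
      Nat.finite_of_card_ne_zero (by rw [hcard]; positivity)
    have h1 : 1 < Nat.card (AddSubgroup.torsionBy Ebar.toAffine.Point ((p + 1 : ℕ) : ℤ)) := by
      rw [hcard]
      nlinarith [hp.two_le]
    haveI := (Finite.one_lt_card_iff_nontrivial.mp h1)
    obtain ⟨⟨R, hR⟩, hR0⟩ :=
      exists_ne (0 : AddSubgroup.torsionBy Ebar.toAffine.Point ((p + 1 : ℕ) : ℤ))
    have hR' : ((p + 1 : ℕ) : ℤ) • R = 0 := (Submodule.mem_torsionBy_iff _ _).mp hR
    rcases R with _ | ⟨u', w', h'⟩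
    · exact hR0 (Subtype.ext rfl)
    · have hpR : (p : ℤ) • (Affine.Point.some u' w' h' : Ebar.toAffine.Point) = 0 := by
        rw [zsmul_some_eq_zero_iff_eval_ΨSq Ebar h', ← hFr, h0, eval_zero]
      have h1R : (1 : ℤ) • (Affine.Point.some u' w' h' : Ebar.toAffine.Point) = 0 := by
        rw [show (1 : ℤ) = ((p + 1 : ℕ) : ℤ) - p by push_cast; ring, sub_zsmul, hR', hpR]
        simp
      rw [one_zsmul] at h1R
      exact Affine.Point.some_ne_zero h' h1R
  -- Step 3: the reduction of `ΨSq_p` is not constant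
  have hdeg : (F.map (IsLocalRing.residue O)).natDegree ≠ 0 := by
    have hcomp : r = (placeResidueEmb p).comp (IsLocalRing.residue O) :=
      RingHom.ext (placeResidueMap_apply p)
    intro h0
    have h0' : (F.map r).natDegree = 0 := by
      rw [hcomp, ← Polynomial.map_map, natDegree_map_eq_of_injective (placeResidueEmb p).injective,
        h0]
    apply hFr0
    rw [eq_C_of_natDegree_eq_zero h0'] at hu ⊢
    rw [eval_C] at hu
    rw [hu, C_0]
  -- Step 4: an integral root `a` of `ΨSq_p`, an integral `b` over it, `P = (a, b) ∈ E(ℚ̄)`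
  obtain ⟨a, ha⟩ := exists_isRoot_of_natDegree_map_residue_ne_zero O F hdeg
  set c₁ : O := M.a₁ * a + M.a₃ with hc₁
  set c₀ : O := a ^ 3 + M.a₂ * a ^ 2 + M.a₄ * a + M.a₆ with hc₀
  have hlt2 : (C c₁ * X - C c₀).degree < ((2 : ℕ) : WithBot ℕ) :=
    (degree_sub_le _ _).trans_lt
      (max_lt ((degree_C_mul_X_le _).trans_lt (by decide)) (degree_C_le.trans_lt (by decide)))
  have hlt : (C c₁ * X - C c₀).degree < (X ^ 2 : O[X]).degree := by
    rwa [degree_X_pow]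
  have hqm : (X ^ 2 + (C c₁ * X - C c₀) : O[X]).Monic := monic_X_pow_add hlt2
  have hqdeg : 0 < (X ^ 2 + (C c₁ * X - C c₀) : O[X]).natDegree := by
    rw [natDegree_add_eq_left_of_degree_lt hlt, natDegree_X_pow]
    exact two_pos
  obtain ⟨b, hb⟩ := exists_eval_eq_zero_placeOver p hqm hqdeg
  have hrootb : b ^ 2 + c₁ * b - c₀ = 0 := by
    have : b ^ 2 + (c₁ * b - c₀) = 0 := by
      simpa only [eval_add, eval_sub, eval_pow, eval_mul, eval_X, eval_C] using hb
    linear_combination this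
  have hab : b ^ 2 + (M.a₁ * a + M.a₃) * b = a ^ 3 + M.a₂ * a ^ 2 + M.a₄ * a + M.a₆ := by
    rw [hc₁, hc₀] at hrootb
    linear_combination hrootb
  -- (no type ascription: keep the tree's elaboration of `W_{ℚ̄}` for the rewrites below)
  have hns := nonsingular_coe_of_eval_eq (W := W) hab
  -- Step 5: `P` is `p`-torsion (`ΨSq_p(a) = 0` read in `ℚ̄`) and reduces to `(ā, b̄) ≠ Õ`
  obtain ⟨h', hred⟩ := geomReduction_some_coe hΔ a b hns
  refine ⟨.some a b hns, (zsmul_some_eq_zero_iff_eval_ΨSq _ hns p).mpr ?_, ?_⟩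
  · rw [← placeModel_baseChange p W]
    change ((M.map (algebraMap O (AlgebraicClosure ℚ))).ΨSq p).eval
      (algebraMap O (AlgebraicClosure ℚ) a) = 0
    rw [map_ΨSq, eval_map, eval₂_at_apply, ← hFdef, ha.eq_zero, map_zero]
  · rw [hred]
    exact Affine.Point.some_ne_zero h'

end Ordinary

end Literature.NumberTheory.EllipticCurves
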